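import Summits.Ventures.DiscreteObjects.Hadamard.ConferenceGraph333EvenAutomorphisms
import Summits.Ventures.DiscreteObjects.Hadamard.ConferenceGraph333Involution
import Summits.Ventures.DiscreteObjects.Hadamard.ConferenceGraph333Order3
import Summits.Ventures.DiscreteObjects.Hadamard.ConferenceGraph333Order4
import Summits.Ventures.DiscreteObjects.Hadamard.ConferenceGraph333PrimeSpectrum
import Summits.Ventures.DiscreteObjects.Hadamard.ConferenceGraph333CompositeOrders

/-!
# The automorphism census of srg(333,166,82,83) ⇔ symmetric C(334) — one summary statement (kernel)

Framing: lottery ticket; floor = certified bounds/negative ranges.  Cell pub-namedobj (venture DiscreteObjects),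
target (H) = `H(668)`, hadamard gen 28.  No new mathematics: this file restates, as ONE conjunction under the
`ConferenceGraph333` hypotheses on the adjacency matrix `A` (`0/1`, symmetric, zero diagonal, row sums `166`,
`A² = 83(J + I) − A`), the census theorems of this generation for UNSIGNED adjacency-preserving permutations `τ`
('automorphisms'; ⇔ automorphisms of a symmetric `C(334)` fixing the border point):
* **`srg333_automorphism_census`** —
  (1) `sign τ = 1` (every automorphism is an even permutation; `ConferenceGraph333EvenAutomorphisms`);
  (2) `τ² = 1 ⇒ #Fix τ ≡ 1 (mod 4)` (`…Involution`);  (3) `τ³ = 1 ⇒ #Fix τ ≡ 3 (mod 6)` (`…Order3`);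
  (4) `τ⁴ = 1 ⇒ #Fix τ² ≡ 2·#Fix τ + 3 (mod 8)` (`…Order4`);
  (5) `τ^p = 1`, `p` prime, `τ ≠ 1 ⇒ p ∈ {2,3,5,7,11,13,17,23,37,41,83}` (`…PrimeSpectrum`);
  (6) no `τ` of order `111, 123, 249, 185, 85, 115, 119, 143` (`…CompositeOrders`).
The fixed-point windows (`aut_prime_windows`), the equitable-partition exclusions (`TwoCells`, `ThreeCells`) and the
group-developed-core theorem (`GroupCore334`) are cited in the docstring only.  Structure of a HYPOTHETICAL object;
`srg(333,166,82,83)`, `C(334)`, `H(668)` are neither constructed nor excluded.  No `sorry`, no new definitions.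
-/

namespace Summit.Ventures.DiscreteObjects.Hadamard

open Finset

section summary
variable {V : Type*} [Fintype V] [DecidableEq V]

/-- **The gen-28 automorphism census of `srg(333,166,82,83)` in one statement.** -/
theorem srg333_automorphism_census (hV : Fintype.card V = 333) (A : Matrix V V ℤ)
    (h01 : ∀ x y, A x y = 0 ∨ A x y = 1) (hsymm : ∀ x y, A y x = A x y) (hdiag : ∀ x, A x x = 0)
    (hk : ∀ x, ∑ y, A x y = 166) (hsrg : ∀ x y, ∑ z, A x z * A z y = 83 * (1 + (if x = y then 1 else 0)) - A x y) :
    (∀ τ : Equiv.Perm V, (∀ x y, A (τ x) (τ y) = A x y) → Equiv.Perm.sign τ = 1) ∧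
    (∀ τ : Equiv.Perm V, (∀ x, τ (τ x) = x) → (∀ x y, A (τ x) (τ y) = A x y) →
      (univ.filter fun x => τ x = x).card % 4 = 1) ∧
    (∀ τ : Equiv.Perm V, (∀ x, τ (τ (τ x)) = x) → (∀ x y, A (τ x) (τ y) = A x y) →
      (univ.filter fun x => τ x = x).card % 6 = 3) ∧
    (∀ τ : Equiv.Perm V, (∀ x, τ (τ (τ (τ x))) = x) → (∀ x y, A (τ x) (τ y) = A x y) →
      (univ.filter fun x => τ (τ x) = x).card % 8 = (2 * (univ.filter fun x => τ x = x).card + 3) % 8) ∧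
    (∀ (p : ℕ) (τ : Equiv.Perm V), p.Prime → τ ^ p = 1 → τ ≠ 1 → (∀ x y, A (τ x) (τ y) = A x y) →
      p = 2 ∨ p = 3 ∨ p = 5 ∨ p = 7 ∨ p = 11 ∨ p = 13 ∨ p = 17 ∨ p = 23 ∨ p = 37 ∨ p = 41 ∨ p = 83) ∧
    (∀ τ : Equiv.Perm V, (∀ x y, A (τ x) (τ y) = A x y) →
      ¬ (τ ^ (3 * 37) = 1 ∧ τ ^ 3 ≠ 1 ∧ τ ^ 37 ≠ 1) ∧ ¬ (τ ^ (3 * 41) = 1 ∧ τ ^ 3 ≠ 1 ∧ τ ^ 41 ≠ 1) ∧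
      ¬ (τ ^ (3 * 83) = 1 ∧ τ ^ 3 ≠ 1 ∧ τ ^ 83 ≠ 1) ∧ ¬ (τ ^ (5 * 37) = 1 ∧ τ ^ 5 ≠ 1 ∧ τ ^ 37 ≠ 1) ∧
      ¬ (τ ^ (5 * 17) = 1 ∧ τ ^ 5 ≠ 1 ∧ τ ^ 17 ≠ 1) ∧ ¬ (τ ^ (5 * 23) = 1 ∧ τ ^ 5 ≠ 1 ∧ τ ^ 23 ≠ 1) ∧
      ¬ (τ ^ (7 * 17) = 1 ∧ τ ^ 7 ≠ 1 ∧ τ ^ 17 ≠ 1) ∧ ¬ (τ ^ (11 * 13) = 1 ∧ τ ^ 11 ≠ 1 ∧ τ ^ 13 ≠ 1)) := by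
  refine ⟨fun τ hA => aut_sign_eq_one hV A h01 hsymm hdiag hk hsrg τ hA,
    fun τ hτ hA => involution_fixedPoints_mod_four hV A h01 hsymm hdiag hk hsrg τ hτ hA,
    fun τ hτ hA => order3_fixedPoints_mod_six hV A h01 hsymm hdiag hk hsrg τ hτ hA,
    fun τ hτ hA => order4_fixedPoints_mod_eight hV A h01 hsymm hdiag hk hsrg τ hτ hA,
    fun p τ hp hτ hτ1 hA => aut_prime_spectrum hV A h01 hsymm hdiag hk hsrg hp τ hτ hτ1 hA,
    fun τ hA => ⟨?_, ?_, ?_, ?_, ?_, ?_, ?_, ?_⟩⟩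
  · rintro ⟨h1, h2, h3⟩; exact no_aut_order_111 hV A h01 hsymm hdiag hk hsrg τ h1 h2 h3 hA
  · rintro ⟨h1, h2, h3⟩; exact no_aut_order_123 hV A h01 hsymm hdiag hk hsrg τ h1 h2 h3 hA
  · rintro ⟨h1, h2, h3⟩; exact no_aut_order_249 hV A h01 hsymm hdiag hk hsrg τ h1 h2 h3 hA
  · rintro ⟨h1, h2, h3⟩; exact no_aut_order_185 hV A h01 hsymm hdiag hk hsrg τ h1 h2 h3 hA
  · rintro ⟨h1, h2, h3⟩; exact no_aut_order_85 hV A h01 hsymm hdiag hk hsrg τ h1 h2 h3 hA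
  · rintro ⟨h1, h2, h3⟩; exact no_aut_order_115 hV A h01 hsymm hdiag hk hsrg τ h1 h2 h3 hA
  · rintro ⟨h1, h2, h3⟩; exact no_aut_order_119 hV A h01 hsymm hdiag hk hsrg τ h1 h2 h3 hA
  · rintro ⟨h1, h2, h3⟩; exact no_aut_order_143 hV A h01 hsymm hdiag hk hsrg τ h1 h2 h3 hA

end summary

end Summit.Ventures.DiscreteObjects.Hadamard
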